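import Literature.AlgebraicGeometry.HodgeTheory.HyperplaneClassLefschetzOperator
import Literature.AlgebraicGeometry.HodgeTheory.HodgeTypePullback
import Literature.AlgebraicGeometry.HodgeTheory.HodgeFiltrationModelsReductionProofs
import Literature.AlgebraicGeometry.HodgeTheory.ComplexConjugationHolds
import Literature.AlgebraicGeometry.HodgeTheory.HodgeModelConnected
import Literature.AlgebraicGeometry.HodgeTheory.HolomorphicBundleChernCharacterProjectiveSpace
import HarnessLib

/-!
# The restricted Fubini–Study class is a positive real multiple of a rational class (Voisin I, Thm. 7.10 surrogate)

Family `hodge`, layer `Literature/AlgebraicGeometry/HodgeTheory`. For `X` smooth projective over `ℂ`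
with a closed immersion `ι : X ⟶ ℙᴺ`, the tree's Kähler form on a Hodge model `B` of `X` is the
restricted Fubini–Study form `θ_X = fubiniStudyPullbackForm B.model ι B.toComplexPoints`
(`Motives/GAGAKaehlerImmersionProofs`: locally `Gⱼ^*β₀` for the affine coordinates `Gⱼ` of the chart
`ι⁻¹D₊(xⱼ)`), and the hyperplane-type class `H ∈ H²(X(ℂ); ℂ)` of a real de Rham family `e` is the
class with `B^*H = e[θ_X] ⊗ 1` (`KaehlerClass`). C. Voisin, *Hodge Theory and Complex Algebraic
Geometry I* (2002), §7.1.3 Thm. 7.10 / §7.1.2 and §11.1.2: `[ω_FS|_X] = c₁(𝒪_X(1)) = [H]` is an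
INTEGRAL class. The tree has no topological first Chern class with which to prove that sentence as
printed; this file proves its consequence actually consumed downstream — **some positive real multiple
`r H` is a RATIONAL class** (`exists_fubiniStudy_rational`, verbatim the hypothesis of
`nonempty_hardLefschetzNFold_of_fubiniStudy_rational` and `hardLefschetz_hodgeRiemann_of_fubiniStudy`,
file `HyperplaneClassLefschetzOperator`) — by functoriality and `b₂(ℙᴺ) = 1`:

1. **`θ_X = (ι^an)^* θ_ℙ`** (`fubiniStudyPullbackForm_eq_pullback`): the affine coordinates
   `ι^*(xᵢ/xⱼ)` of `X` are the pull-backs of the coordinates `xᵢ/xⱼ` of `ℙᴺ`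
   (`GeneratingSections.homRatio_eq_appLE`: the chart lift of `ι` factors through that of `𝟙 ℙᴺ`,
   Hartshorne II Thm. 7.1 (a)), so their values at `Q ∈ X(ℂ)` are the values at `ι(Q)`
   (`evalOrZero_homRatio_eq`, `AlgPoints.eval_map`), the coordinate maps `Gⱼ` of `X^an` are those of
   `(ℙᴺ)^an` composed with the analytified morphism `ι^an` (`HodgeModel.anMap`, holomorphic: Serre,
   GAGA §2 n°5), and `Gⱼ^*β₀ = (ι^an)^*(Gⱼ^*β₀)` by the chain rule.
2. Consequently `ι^an` is an immersion (`θ_X` is positive, `fubiniStudyPullbackForm_pos`), whence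
   `dim X ≤ N` (`dim_le_of_isClosedImmersion_projectiveSpace`), the inequality needed for:
3. **`B^*(ι(ℂ)^* c_ℙ) = e''[θ_X ⊗ 1]`** for the class `c_ℙ ∈ H²(ℙᴺ(ℂ); ℂ)` with
   `A^* c_ℙ = A.deRham [θ_ℙ ⊗ 1]` in a Hodge model `A` of `ℙᴺ`, `e''` the comparison INDUCED on
   `B.model`-manifolds from `A.deRham` (`HodgeModel.inducedIso`, file `HodgeTypePullback`: naturality
   of `A.deRham` along `ι^an ∘ π : Cyl X^an → (ℙᴺ)^an`).
4. **Rigidity** (`NaturalDeRhamComparisonRigidity_holds`): the natural families `e ⊗ ℂ` and `e''`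
   over `B.model`-manifolds differ on `H²_dR(X^an; ℂ)` by a complex scalar, so `H = r · ι(ℂ)^* c_ℙ`.
5. **`H²(ℙᴺ(ℂ); ℂ) ≅ ℂ`** (`finrank_complexBetti_projectiveSpace_two_mul_eq_one`, Hatcher Thm. 3.19)
   is spanned by its rational classes (`span_isRationalClass_eq_top_of_isSmoothProjective_holds`), so
   `c_ℙ = λ ρ_ℙ` with `ρ_ℙ` rational and `H = μ · ι(ℂ)^*ρ_ℙ`, `ι(ℂ)^*ρ_ℙ` rational
   (`IsRationalClass.map`); `H` is real (a Kähler class, `IsKaehlerClassVia.conjClass_eq`) and so is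
   `ι(ℂ)^*ρ_ℙ` (`IsRationalClass.conjClass_eq`), hence `μ ∈ ℝ` and `|μ|⁻¹ H = ±ι(ℂ)^*ρ_ℙ` is rational.

Consequence (not recorded here; the named fact `nonempty_hardLefschetzNFold n X` of file
`HardLefschetzNFold` is claimed by another seat): hard Lefschetz for a rational hyperplane-type class,
Voisin I Thm. 6.25 / §7.1.2, follows in one line,
`nonempty_hardLefschetzNFold_of_fubiniStudy_rational fun hX ↦ exists_fubiniStudy_rational hX`.
The present file is the input `B3` (a RATIONAL Kähler class) of the polarization of the Hodge
structure on `Hᵏ(X(ℂ); ℚ)` (`smoothProjective_hodgeStructure_isPolarizable`, Voisin I §7.1.2).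

No definition and no named fact is introduced (D-0026).

## References

* [VoisinHodgeI2002] C. Voisin, Hodge Theory and Complex Algebraic Geometry I (CUP 2002), §3.1.3,
  §3.3.2 Lemma 3.16, Thm. 6.25, Rem. 6.27, §7.1.2, §7.1.3 Thm. 7.10, §11.1.2.
* [Hartshorne1977] R. Hartshorne, Algebraic Geometry (GTM 52, 1977), II Thm. 7.1 (a).
* [SerreGAGA1956] J.-P. Serre, Géométrie algébrique et géométrie analytique, Ann. Inst. Fourier 6
  (1956), §2 n°5.
* [HatcherAT2002] A. Hatcher, Algebraic Topology (CUP 2002), Thm. 3.19.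
-/

open CategoryTheory AlgebraicGeometry Limits HomogeneousLocalization TopologicalSpace Opposite
open MvPolynomial (X C)
open Literature.AlgebraicGeometry.Motives.Segre
open Literature.AlgebraicGeometry.Motives

attribute [local instance] MvPolynomial.gradedAlgebra

universe u

noncomputable section


namespace Literature.AlgebraicGeometry.HodgeTheory

open GeneratingSections Literature.AlgebraicGeometry.Motives.AlgPoints
open Literature.AlgebraicGeometry.Motives.AnalytificationKaehler
open Literature.NumberTheory.Transcendental Literature.Geometry.Kaehler
open Literature.AlgebraicTopology.SingularHomology
open scoped Manifold ContDiff Topology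

section Scheme

variable {σ : Type} {k : Type u} [CommRing k] {Y : Scheme.{u}} (r : Y ⟶ Proj (grading σ k))

/-- `r⁻¹D₊(xⱼ)` is the preimage of `(𝟙 ℙ)⁻¹D₊(xⱼ)` (definitional). [folklore] -/
theorem preU_eq_preimage_preU_id (j : σ) :
    preU r j = r ⁻¹ᵁ preU (𝟙 (Proj (grading σ k))) j := rfl

/-- The chart lift `r⁻¹D₊(xⱼ) → D₊(xⱼ) = Spec (k[x]_{(xⱼ)})₀` of a morphism `r : Y → ℙ` factors through
the restriction of `r` and the chart lift of `𝟙 ℙ` (uniqueness of lifts along the open immersion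
`D₊(xⱼ) ↪ ℙ`). [cite: Hartshorne1977, II Thm. 7.1 (a)] -/
theorem chartLift_eq_resLE_comp (j : σ) :
    chartLift r j =
      r.resLE (preU (𝟙 (Proj (grading σ k))) j) (preU r j) (preU_eq_preimage_preU_id r j).le ≫
        chartLift (𝟙 (Proj (grading σ k))) j := by
  symm
  refine IsOpenImmersion.lift_uniq _ _ _ _ ?_
  rw [Category.assoc, chartLift_chartι, Category.comp_id, Scheme.Hom.resLE_comp_ι]

/-- **The ratios `r^*(xᵢ/xⱼ)` are the pull-backs of the ratios `xᵢ/xⱼ` of `ℙ`** along `r`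
(`Scheme.Hom.appLE`; Hartshorne II Thm. 7.1 (a): `sᵢ = φ^* xᵢ`). [cite: Hartshorne1977, II Thm. 7.1 (a)] -/
theorem homRatio_eq_appLE (j i : σ) :
    homRatio r j i =
      r.appLE (preU (𝟙 (Proj (grading σ k))) j) (preU r j) (preU_eq_preimage_preU_id r j).le
        (homRatio (𝟙 (Proj (grading σ k))) j i) := by
  rw [homRatio, homRatio, chartLift_eq_resLE_comp, pull_comp, RingHom.comp_apply]
  have h := Scheme.Hom.resLE_app_top r (preU_eq_preimage_preU_id r j).le
    (U := preU (𝟙 (Proj (grading σ k))) j) (V := preU r j)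
  change (preU r j).topIso.hom ((Scheme.Hom.resLE r (preU (𝟙 (Proj (grading σ k))) j) (preU r j)
    (preU_eq_preimage_preU_id r j).le).app ⊤ _) = _
  rw [h]
  erw [CommRingCat.comp_apply, CommRingCat.comp_apply, Iso.inv_hom_id_apply]
  rfl

end Scheme

section Points

variable {N : ℕ} {X : SchemeOver ℂ} (ι : X ⟶ projectiveSpace N ℂ)

/-- Evaluation of a pulled-back function: `(f^* s)(P) = s(f(P))` for `s ∈ Γ(Y, V)`, `P ∈ U(ℂ)`,
`U ⊆ f⁻¹V` (`AlgPoints.eval_map` and restriction; a copy of `Motives.eval_appLE` of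
`SmoothMorphismSubmersion`, not imported). [folklore] -/
theorem eval_appLE_of_le {Y : SchemeOver ℂ} (f : X ⟶ Y) {V : Y.left.Opens} {U : X.left.Opens}
    (hle : U ≤ f.left ⁻¹ᵁ V) (P : Motives.ComplexPoints X) (hPU : P.pt ∈ U) (s : Γ(Y.left, V)) :
    P.eval U hPU (f.left.appLE V U hle s) = (Motives.AlgPoints.map f P).eval V (hle hPU) s := by
  rw [Motives.AlgPoints.eval_map]
  exact Motives.AlgPoints.eval_map_homOfLE hle _ hPU

/-- **The affine coordinates of `X → ℙᴺ` are those of `ℙᴺ` at the image point**: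
`ι^*(xᵢ/xⱼ)(Q) = (xᵢ/xⱼ)(ι(Q))` as total evaluations (both vanish off the chart
`ι⁻¹D₊(xⱼ) = ι⁻¹((𝟙 ℙ)⁻¹D₊(xⱼ))`). [cite: Hartshorne1977, II Thm. 7.1 (a)] -/
theorem evalOrZero_homRatio_eq (j i : Fin (N + 1)) (Q : Motives.ComplexPoints X) :
    evalOrZero (preU ι.left j) (homRatio ι.left j i) Q =
      evalOrZero (preU (𝟙 (projectiveSpace N ℂ).left) j) (homRatio (𝟙 (projectiveSpace N ℂ).left) j i)
        (Motives.AlgPoints.map ι Q) := by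
  by_cases hQ : Q.pt ∈ preU ι.left j
  · have hQ' : (Motives.AlgPoints.map ι Q).pt ∈ preU (𝟙 (projectiveSpace N ℂ).left) j := hQ
    rw [evalOrZero_of_mem _ hQ, evalOrZero_of_mem _ hQ', homRatio_eq_appLE ι.left j i]
    exact eval_appLE_of_le ι (preU_eq_preimage_preU_id ι.left j).le Q hQ _
  · have hQ' : (Motives.AlgPoints.map ι Q).pt ∉ preU (𝟙 (projectiveSpace N ℂ).left) j := hQ
    rw [evalOrZero_of_not_mem _ hQ, evalOrZero_of_not_mem _ hQ']

variable {M M' : Type*} (φ : M → Motives.ComplexPoints X)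
  (φ' : M' → Motives.ComplexPoints (projectiveSpace N ℂ)) (f : M → M')
  (hf : ∀ m, φ' (f m) = Motives.AlgPoints.map ι (φ m))

include hf in
/-- The affine coordinate functions `Gⱼ` of `X` read on `M` are those of `ℙᴺ` read on `M'`,
composed with any map `f : M → M'` over `ι(ℂ)` (`φ' ∘ f = ι(ℂ) ∘ φ`). [cite: VoisinHodgeI2002, §3.3.2] -/
theorem coordFun_eq_coordFun_id_comp (j : Fin (N + 1)) :
    coordFun ι φ j = coordFun (𝟙 (projectiveSpace N ℂ)) φ' j ∘ f := by
  funext m i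
  change evalOrZero (preU ι.left j) (homRatio ι.left j i) (φ m) =
    evalOrZero (preU (𝟙 (projectiveSpace N ℂ).left) j) (homRatio (𝟙 (projectiveSpace N ℂ).left) j i)
      (φ' (f m))
  rw [hf, evalOrZero_homRatio_eq]

include hf in
/-- The coordinate vectors `Gⱼ : M → ℂᴺ⁺¹` of `X` are those of `ℙᴺ` composed with any map over
`ι(ℂ)`. [cite: VoisinHodgeI2002, §3.3.2] -/
theorem coordVec_eq_coordVec_id_comp (j : Fin (N + 1)) :
    coordVec ι φ j = coordVec (𝟙 (projectiveSpace N ℂ)) φ' j ∘ f := by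
  funext m
  change (EuclideanSpace.equiv (Fin (N + 1)) ℂ).symm (coordFun ι φ j m) =
    (EuclideanSpace.equiv (Fin (N + 1)) ℂ).symm (coordFun (𝟙 (projectiveSpace N ℂ)) φ' j (f m))
  rw [coordFun_eq_coordFun_id_comp ι φ φ' f hf]
  rfl

include hf in
/-- The chart domains `Mⱼ = φ⁻¹(ι⁻¹D₊(xⱼ)(ℂ))` correspond under any map over `ι(ℂ)`. [folklore] -/
theorem mem_chartDom_iff_comp (j : Fin (N + 1)) (m : M) :
    m ∈ chartDom ι φ j ↔ f m ∈ chartDom (𝟙 (projectiveSpace N ℂ)) φ' j := by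
  change (φ m).pt ∈ preU ι.left j ↔ (φ' (f m)).pt ∈ preU (𝟙 (projectiveSpace N ℂ).left) j
  rw [hf]
  rfl

end Points

section Forms

variable {N : ℕ} {X : SchemeOver ℂ} (ι : X ⟶ projectiveSpace N ℂ)
  {E : Type*} [NormedAddCommGroup E] [NormedSpace ℂ E] [FiniteDimensional ℂ E]
  {E' : Type*} [NormedAddCommGroup E'] [NormedSpace ℂ E'] [FiniteDimensional ℂ E']
  {M : Type*} [TopologicalSpace M] [ChartedSpace E M]
  {M' : Type*} [TopologicalSpace M'] [ChartedSpace E' M']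
  {φ : M → Motives.ComplexPoints X} {n : ℕ}
  {φ' : M' → Motives.ComplexPoints (projectiveSpace N ℂ)}
  (hφ' : IsAnalytification E' (projectiveSpace N ℂ) N φ')
  {f : M → M'} (hf : ∀ m, φ' (f m) = Motives.AlgPoints.map ι (φ m))
  (hfd : MDifferentiable 𝓘(ℝ, E) 𝓘(ℝ, E') f)

omit [FiniteDimensional ℂ E] [FiniteDimensional ℂ E'] in
/-- Chain rule for the vector-valued differential. [folklore] -/
private theorem mvfderiv_comp_apply' {F : Type*} [NormedAddCommGroup F] [NormedSpace ℝ F]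
    {g : M' → F} {m : M} (hg : MDifferentiableAt 𝓘(ℝ, E') 𝓘(ℝ, F) g (f m))
    (hfm : MDifferentiableAt 𝓘(ℝ, E) 𝓘(ℝ, E') f m) (v : TangentSpace 𝓘(ℝ, E) m) :
    mvfderiv 𝓘(ℝ, E) (g ∘ f) m v = mvfderiv 𝓘(ℝ, E') g (f m) (mfderiv 𝓘(ℝ, E) 𝓘(ℝ, E') f m v) := by
  simp only [mvfderiv, ContinuousLinearMap.comp_apply]
  rw [mfderiv_comp m hg hfm]
  rfl

omit [FiniteDimensional ℂ E] in
include hφ' hf hfd in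
/-- **The restricted Fubini–Study form is the pull-back of the Fubini–Study form of `ℙᴺ`.** For
analytifications `φ : M → X(ℂ)` and `φ' : M' → ℙᴺ(ℂ)` and a real-differentiable map `f : M → M'`
over `ι(ℂ)`, the candidate Kähler form `θ_X` of `GAGAKaehlerImmersionProofs` (locally `Gⱼ^*β₀`,
`Gⱼ` the affine coordinates of the chart `ι⁻¹D₊(xⱼ)`) is `f^*θ_ℙ`: the coordinates of `X` are those
of `ℙᴺ` composed with `f` (`coordVec_eq_coordVec_id_comp`), the charts correspond, the choice of
chart is immaterial (`fsPullback_coordVec_eq`), and `(G ∘ f)^*β₀ = f^*(G^*β₀)` by the chain rule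
(Voisin (2002), §3.3.2: the Fubini–Study form of `ℙᴺ` «restricted to `X`»; §3.1.3: pull-backs of
Kähler forms along immersions). [cite: VoisinHodgeI2002, §3.1.3 and §3.3.2 Lemma 3.16] -/
theorem fubiniStudyPullbackForm_eq_pullback :
    fubiniStudyPullbackForm E ι φ =
      (fubiniStudyPullbackForm E' (𝟙 (projectiveSpace N ℂ)) φ').pullback 𝓘(ℝ, E) f := by
  funext m
  set j := chartIndex (ι := ι) (φ := φ) m with hj
  have hm : m ∈ chartDom ι φ j := mem_chartDom_chartIndex m
  have hm' : f m ∈ chartDom (𝟙 (projectiveSpace N ℂ)) φ' j :=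
    (mem_chartDom_iff_comp ι φ φ' f hf j m).1 hm
  have hθ' : fubiniStudyPullbackForm E' (𝟙 (projectiveSpace N ℂ)) φ' (f m) =
      fsPullback E' (coordVec (𝟙 (projectiveSpace N ℂ)) φ' j) (f m) :=
    fsPullback_coordVec_eq hφ' hm' (mem_chartDom_chartIndex (f m))
  have hG' : MDifferentiableAt 𝓘(ℝ, E') 𝓘(ℝ, EuclideanSpace ℂ (Fin (N + 1)))
      (coordVec (𝟙 (projectiveSpace N ℂ)) φ' j) (f m) :=
    (mdifferentiableAt_coordVec hφ' hm').real_of_complex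
  ext v
  rw [MForm.pullback_apply, hθ']
  change fsPullback E (coordVec ι φ j) m v = _
  rw [fsPullback_apply', fsPullback_apply', coordVec_eq_coordVec_id_comp ι φ φ' f hf j,
    Function.comp_apply, mvfderiv_comp_apply' hG' (hfd m), mvfderiv_comp_apply' hG' (hfd m)]

end Forms

section Dimension

variable {n N : ℕ} {X : SchemeOver ℂ}

/-- **`dim X ≤ N` for a smooth projective `X` with a closed immersion into `ℙᴺ`**, proved
analytically on Hodge models `B` of `X` and `A` of `ℙᴺ`: the analytified morphism
`ι^an : X^an → (ℙᴺ)^an` (`HodgeModel.anMap`, holomorphic by GAGA) is an immersion, because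
`θ_X = (ι^an)^*θ_ℙ` (`fubiniStudyPullbackForm_eq_pullback`) and `θ_X(v, Jv) > 0` for `v ≠ 0`
(`fubiniStudyPullbackForm_pos`) while `d(ι^an)` is `ℂ`-linear; hence
`2n = dim_ℝ B.model ≤ dim_ℝ A.model = 2N`. [cite: VoisinHodgeI2002, §3.3.2 Lemma 3.16]
[cite: SerreGAGA1956, §2 n°5] -/
theorem dim_le_of_isClosedImmersion_projectiveSpace (hX : Motives.IsSmoothProjective n X)
    (ι : X ⟶ projectiveSpace N ℂ) [IsClosedImmersion ι.left] (B : HodgeModel n X)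
    (A : HodgeModel N (projectiveSpace N ℂ)) : n ≤ N := by
  have hP : Motives.IsSmoothProjective N (projectiveSpace N ℂ) :=
    Motives.isSmoothProjective_projectiveSpace_holds ℂ N
  set f := HodgeModel.anMap A B ι with hf
  have hfd : MDifferentiable 𝓘(ℝ, B.model) 𝓘(ℝ, A.model) f :=
    (HodgeModel.mdifferentiable_anMap A B ι hX hP).real_of_complex
  have hθ := fubiniStudyPullbackForm_eq_pullback ι (E := B.model) (φ := B.toComplexPoints)
    A.isAnalytification (f := f) (HodgeModel.toComplexPoints_anMap A B ι) hfd
  obtain ⟨m₀⟩ := B.nonempty_carrier hX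
  haveI := hX.smoothOfRelativeDimension
  -- `df(m₀)` is injective
  have hinj : Function.Injective (mfderiv 𝓘(ℝ, B.model) 𝓘(ℝ, A.model) f m₀) := by
    refine (injective_iff_map_eq_zero _).2 fun v hv ↦ ?_
    by_contra hv0
    have hpos := fubiniStudyPullbackForm_pos (ι := ι) B.isAnalytification m₀ v hv0
    rw [hθ, MForm.pullback_apply] at hpos
    have hJ : mfderiv 𝓘(ℝ, B.model) 𝓘(ℝ, A.model) f m₀ (tangentJ B.model m₀ v) = 0 := by
      rw [tangentJ_apply, mfderiv_real_apply_smul (HodgeModel.mdifferentiable_anMap A B ι hX hP m₀), hv]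
      exact smul_zero (A := A.model) Complex.I
    have h0 : (fun i ↦ mfderiv 𝓘(ℝ, B.model) 𝓘(ℝ, A.model) f m₀ (![v, tangentJ B.model m₀ v] i)) = 0 := by
      funext i
      fin_cases i
      · exact hv
      · exact hJ
    rw [h0, ContinuousAlternatingMap.map_zero] at hpos
    exact lt_irrefl _ hpos
  have h := LinearMap.finrank_le_finrank_of_injective
    (f := (mfderiv 𝓘(ℝ, B.model) 𝓘(ℝ, A.model) f m₀ : B.model →L[ℝ] A.model).toLinearMap) hinj
  change Module.finrank ℝ B.model ≤ Module.finrank ℝ A.model at h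
  rw [finrank_real_of_complex, finrank_real_of_complex, B.isAnalytification.finrank_eq,
    A.isAnalytification.finrank_eq] at h
  omega

end Dimension

section Main

variable {n : ℕ} {X : SchemeOver ℂ}

/-- Complexification `β ↦ β ⊗ 1` commutes with the pull-back of forms (definitional). [folklore] -/
theorem mform_ofReal_pullback {E E' : Type*} [NormedAddCommGroup E] [NormedSpace ℂ E]
    [NormedAddCommGroup E'] [NormedSpace ℂ E'] {M M' : Type*} [TopologicalSpace M] [ChartedSpace E M]
    [TopologicalSpace M'] [ChartedSpace E' M'] {k : ℕ} (β : MForm 𝓘(ℝ, E') M' ℝ k) (f : M → M') :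
    (β.pullback 𝓘(ℝ, E) f).ofReal = β.ofReal.pullback 𝓘(ℝ, E) f := by
  funext x; rfl

/-- In a `1`-dimensional space spanned by a set, some element of the set is non-zero and every
vector is a multiple of it. [folklore] -/
theorem exists_mem_ne_zero_of_span_eq_top {K V : Type*} [Field K] [AddCommGroup V] [Module K V]
    {S : Set V} (hS : Submodule.span K S = ⊤) (h1 : Module.finrank K V = 1) :
    ∃ v ∈ S, v ≠ 0 ∧ ∀ w : V, ∃ c : K, c • v = w := by
  by_contra! hcon
  have hbot : Submodule.span K S = ⊥ := by
    rw [Submodule.span_eq_bot]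
    intro v hv
    by_contra hv0
    obtain ⟨w, hw⟩ := hcon v hv hv0
    exact hw _ ((finrank_eq_one_iff_of_nonzero' v hv0).1 h1 w).choose_spec
  rw [hbot] at hS
  haveI : Module.Finite K V := Module.finite_of_finrank_eq_succ h1
  have h0 : Module.finrank K V = 0 := by
    rw [← finrank_top, ← hS, finrank_bot]
  omega

/-- **The restricted Fubini–Study class is a real multiple of a rational class** (the tree's
surrogate for Voisin I Thm. 7.10, `[ω_FS|_X] = c₁(𝒪_X(1)) ∈ H²(X, ℤ)`): for `X` smooth projective of
dimension `n` there are a Hodge model `A`, a closed immersion `ι : X ⟶ ℙᴺ`, a natural multiplicative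
real de Rham family `e`, the class `H ∈ H²(X(ℂ); ℂ)` with `A^* H = e[θ] ⊗ 1` for the restricted
Fubini–Study form `θ` of `ι`, and `r > 0` with `r H` rational. Proof: `θ = (ι^an)^* θ_ℙ`
(`fubiniStudyPullbackForm_eq_pullback`); by the induced comparison of `HodgeTypePullback` and the
rigidity of natural de Rham comparisons (`NaturalDeRhamComparisonRigidity_holds`), `H` is a complex
multiple of `ι(ℂ)^* c` for any class `c ∈ H²(ℙᴺ(ℂ); ℂ) ≅ ℂ` (`finrank_complexBetti_projectiveSpace_two_mul`),
which is spanned by a rational class (`span_isRationalClass_eq_top_of_isSmoothProjective_holds`);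
`H` and rational classes being real (`IsKaehlerClassVia.conjClass_eq`,
`IsRationalClass.conjClass_eq`), the multiple is real, and its sign is absorbed into the rational
class. For `N = 0`, `H²(ℙ⁰(ℂ); ℂ) = 0` and `H = 0`. This is the hypothesis `h` of
`nonempty_hardLefschetzNFold_of_fubiniStudy_rational` (file `HyperplaneClassLefschetzOperator`),
verbatim. [cite: VoisinHodgeI2002, §7.1.2 and §7.1.3 Thm. 7.10] [cite: SerreGAGA1956, §2 n°5] -/
theorem exists_fubiniStudy_rational (hX : Motives.IsSmoothProjective n X) :
    ∃ (A : HodgeModel n X) (N : ℕ) (ι : X ⟶ Motives.projectiveSpace N ℂ) (_ : IsClosedImmersion ι.left)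
      (e : DeRhamIsoFamily 𝓘(ℝ, A.model)) (_ : e.IsNatural) (_ : e.IsMultiplicative)
      (hθ : fubiniStudyPullbackForm A.model ι A.toComplexPoints ∈ closedSmoothForms 𝓘(ℝ, A.model) A.carrier ℝ 2)
      (H : complexBetti X 2) (r : ℝ),
      A.pullback 2 H = ofRealClass A.carrier 2 (e A.carrier 2
        (deRhamCohomology.mk ⟨fubiniStudyPullbackForm A.model ι A.toComplexPoints, hθ⟩)) ∧
      0 < r ∧ IsRationalClass ((r : ℂ) • H) := by
  obtain ⟨N, ι, hι⟩ := hX.isProjectiveOver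
  haveI := hι
  obtain ⟨B, -⟩ := exists_isReal_hodgeModel_holds n X hX
  have hP : Motives.IsSmoothProjective N (Motives.projectiveSpace N ℂ) :=
    Motives.isSmoothProjective_projectiveSpace_holds ℂ N
  obtain ⟨A, -⟩ := exists_isReal_hodgeModel_holds N (Motives.projectiveSpace N ℂ) hP
  obtain ⟨e, he, hem, -⟩ := exists_deRhamIsoFamily_holds B.model
  have hθ := B.fubiniStudyPullbackForm_mem_closedSmoothForms ι
  obtain ⟨H, hH⟩ := B.pullback_surjective 2 (ofRealClass B.carrier 2 (e B.carrier 2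
    (deRhamCohomology.mk ⟨fubiniStudyPullbackForm B.model ι B.toComplexPoints, hθ⟩)))
  refine ⟨B, N, ι, hι, e, he, hem, hθ, H, ?_⟩
  -- it suffices to show that `H` is a complex multiple of a rational class
  suffices hrat : ∃ (ρ : complexBetti X 2) (μ : ℂ), IsRationalClass ρ ∧ H = μ • ρ by
    obtain ⟨ρ, μ, hρ, rfl⟩ := hrat
    by_cases h0 : μ • ρ = 0
    · refine ⟨1, hH, one_pos, ?_⟩
      rw [h0, smul_zero]
      exact IsRationalClass.zero
    have hK : B.IsKaehlerClassVia e (μ • ρ) :=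
      B.isKaehlerClassVia_of_pullback_eq_fubiniStudyPullbackForm e hX ι hθ hH
    have hconj := hK.conjClass_eq
    rw [conjClass_smul, hρ.conjClass_eq] at hconj
    have hρ0 : ρ ≠ 0 := fun h ↦ h0 (by rw [h, smul_zero])
    have hμ : starRingEnd ℂ μ = μ := smul_left_injective ℂ hρ0 hconj
    have hμre : (μ.re : ℂ) = μ := Complex.conj_eq_iff_re.1 hμ
    have hμ0 : μ.re ≠ 0 := fun h ↦ h0 (by rw [← hμre, h, Complex.ofReal_zero, zero_smul])
    refine ⟨|μ.re|⁻¹, hH, inv_pos.2 (abs_pos.2 hμ0), ?_⟩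
    rw [smul_smul, show ((|μ.re|⁻¹ : ℝ) : ℂ) * μ = ((|μ.re|⁻¹ * μ.re : ℝ) : ℂ) by
      rw [Complex.ofReal_mul, hμre]]
    rcases lt_or_gt_of_ne hμ0 with hneg | hpos
    · rw [abs_of_neg hneg, inv_neg, neg_mul, inv_mul_cancel₀ hμ0, Complex.ofReal_neg,
        Complex.ofReal_one]
      have h := hρ.smul (-1)
      rwa [Rat.cast_neg, Rat.cast_one] at h
    · rw [abs_of_pos hpos, inv_mul_cancel₀ hμ0, Complex.ofReal_one, one_smul]
      exact hρ
  -- the analytified embedding and `θ_X = (ι^an)^* θ_ℙ`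
  have hmn : n ≤ N := dim_le_of_isClosedImmersion_projectiveSpace hX ι B A
  set f := HodgeModel.anMap A B ι with hfdef
  have hfan : ContMDiff 𝓘(ℝ, B.model) 𝓘(ℝ, A.model) ∞ f := HodgeModel.contMDiff_anMap A B ι hX hP
  have hfd : MDifferentiable 𝓘(ℝ, B.model) 𝓘(ℝ, A.model) f :=
    (HodgeModel.mdifferentiable_anMap A B ι hX hP).real_of_complex
  have hθX := fubiniStudyPullbackForm_eq_pullback ι (E := B.model) (φ := B.toComplexPoints)
    A.isAnalytification (f := f) (HodgeModel.toComplexPoints_anMap A B ι) hfd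
  have hθP := A.fubiniStudyPullbackForm_mem_closedSmoothForms (𝟙 (Motives.projectiveSpace N ℂ))
  -- the de Rham classes of `θ_ℙ ⊗ 1` and `θ_X ⊗ 1`
  set wP : complexDeRhamCohomology A.model A.carrier 2 :=
    complexDeRhamCohomology.ofReal A.model A.carrier 2
      (deRhamCohomology.mk ⟨fubiniStudyPullbackForm A.model (𝟙 (Motives.projectiveSpace N ℂ)) A.toComplexPoints, hθP⟩) with hwP
  set wX : complexDeRhamCohomology B.model B.carrier 2 :=
    complexDeRhamCohomology.ofReal B.model B.carrier 2
      (deRhamCohomology.mk ⟨fubiniStudyPullbackForm B.model ι B.toComplexPoints, hθ⟩) with hwX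
  have hwPX : complexDeRhamCohomology.map B.model hfan 2 wP = wX := by
    rw [hwP, hwX, complexDeRhamCohomology.ofReal_mk, complexDeRhamCohomology.ofReal_mk,
      complexDeRhamCohomology.map_mk]
    congr 1
    apply Subtype.ext
    change (fubiniStudyPullbackForm A.model (𝟙 (Motives.projectiveSpace N ℂ)) A.toComplexPoints).ofReal.pullback 𝓘(ℝ, B.model) f =
      (fubiniStudyPullbackForm B.model ι B.toComplexPoints).ofReal
    rw [hθX, mform_ofReal_pullback]
  -- a class `c_ℙ` on `ℙᴺ(ℂ)` comparing to `θ_ℙ ⊗ 1` in the model `A`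
  obtain ⟨cP, hcP⟩ := A.pullback_surjective 2 (A.deRham A.carrier 2 wP)
  -- compatibility compactness instances on `X^an`
  haveI : CompactSpace B.carrier := by
    haveI := Motives.ComplexPoints.compactSpace_of_isSmoothProjective hX
    exact B.isAnalytification.homeomorph.symm.compactSpace
  -- (d) the induced comparison: `B^*(ι^* c_ℙ) = e''[θ_X ⊗ 1]`
  have hd : HodgeModel.inducedIso A B hmn B.carrier 2 wX =
      B.pullback 2 (singularCohomology.map ℂ ℂ (Motives.AlgPoints.mapContinuous (L := ℂ) ι) 2 cP) := by
    rw [← hwPX, HodgeModel.inducedIso_apply,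
      ← LinearMap.comp_apply (g := complexDeRhamCohomology.map B.model hfan 2),
      ← complexDeRhamCohomology.map_comp hfan (contMDiff_cylFst A B hmn B.carrier),
      A.deRham_isNatural (Cyl A B hmn B.carrier) A.carrier _
        (hfan.comp (contMDiff_cylFst A B hmn B.carrier)) 2 wP,
      ← hcP, ← HodgeModel.map_anMap_pullback]
    change ((singularCohomology.map ℂ ℂ _ 2 ≫ singularCohomology.map ℂ ℂ _ 2).hom _) = _
    rw [← singularCohomology.map_comp]
    rfl
  -- (e) rigidity: `e ⊗ ℂ = r • e''` on `H²_dR(X^an; ℂ)`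
  obtain ⟨r, hr⟩ := NaturalDeRhamComparisonRigidity_holds B.model B.model
    (HodgeModel.inducedFamily A B hmn) (HodgeModel.isNatural_inducedFamily A B hmn)
    e.complexify (DeRhamIsoFamily.complexify_isNatural he) B.carrier B.carrier (Homeomorph.refl _)
    contMDiff_id contMDiff_id 2
  have hrX : e.complexify B.carrier 2 wX = r • HodgeModel.inducedIso A B hmn B.carrier 2 wX := by
    have h := hr wX
    have hid : (⟨Homeomorph.refl B.carrier, (Homeomorph.refl B.carrier).continuous⟩ :
        C(B.carrier, B.carrier)) = ContinuousMap.id B.carrier := rfl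
    rw [hid, singularCohomology.map_id] at h
    change e.complexify B.carrier 2 wX =
      r • HodgeModel.inducedIso A B hmn B.carrier 2 (complexDeRhamCohomology.map B.model contMDiff_id 2 wX) at h
    rwa [complexDeRhamCohomology.map_id, LinearMap.id_apply] at h
  -- hence `H = r • ι^* c_ℙ`
  have hH' : H = r • singularCohomology.map ℂ ℂ (Motives.AlgPoints.mapContinuous (L := ℂ) ι) 2 cP := by
    apply B.pullback_injective 2
    rw [hH, _root_.map_smul, ← hd, ← hrX, complexify_apply, hwX, complexifyFun_ofReal]
  -- (f) `H²(ℙᴺ(ℂ); ℂ)` is spanned by one rational class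
  rcases Nat.eq_zero_or_pos N with hN | hN
  · subst hN
    haveI := Motives.ComplexPoints.subsingleton_singularCohomology_of_lt hP ℂ (k := 2) (by omega)
    refine ⟨0, 0, IsRationalClass.zero, ?_⟩
    rw [hH', Subsingleton.elim cP 0, map_zero, smul_zero, smul_zero]
  have h1 : Module.finrank ℂ (complexBetti (Motives.projectiveSpace N ℂ) 2) = 1 :=
    finrank_complexBetti_projectiveSpace_two_mul_eq_one N (p := 1) hN
  obtain ⟨rP, hrP, -, hspan⟩ := exists_mem_ne_zero_of_span_eq_top
    (span_isRationalClass_eq_top_of_isSmoothProjective_holds N (Motives.projectiveSpace N ℂ) hP 2) h1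
  obtain ⟨lam, hlam⟩ := hspan cP
  refine ⟨singularCohomology.map ℂ ℂ (Motives.AlgPoints.mapContinuous (L := ℂ) ι) 2 rP, r * lam,
    IsRationalClass.map _ hrP, ?_⟩
  rw [hH', ← hlam, _root_.map_smul, smul_smul]

end Main

end Literature.AlgebraicGeometry.HodgeTheory

end
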